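import Summits.HubbardSuperconductivity.HubbardSuperconductivity.Theorems.AnisotropyChordTransferFibre3RowCXSCells
import Summits.HubbardSuperconductivity.HubbardSuperconductivity.Theorems.AnisotropyChordTransferFibre3L2TCellRB064N33383

/-!
# Route `AnisotropyChord` / H0 rotor rung, LEVEL 2 row C (KT-2b), t-BLOCK `64 ≤ L ≤ 95`: the X-sum bracket of the column `ν ∈ [33383, 34218]/10⁶`

The L-uniform bracket of the positive Parseval sum of the phase-defect moment on p2's block cell `L2.N1.tcRB064N33383` (window `K = 16`, `T = 964/100000`,
the column's certified totals `θ⁴S₂ ≤ 80693717/12500000`, `θ⁴T10 ≤ 3969754003/1000000000`): ★ `xsTB064N33383` : `RowC.xsCellCheck 64 … (512/100) = true` — for every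
`L ≥ 64` and every `ν` in the column, `XSn(L, νθ²) ≤ 512/100` (`RowC.xs_cell_sound`; exact-ℚ mirror value 5.0923; at `L₀ = 128`, `K = 32` the
same column has ≈ 4.2); one kernel `decide`; shared by all row-C cells `…RowCTFB064N33383C…` of this column.
Prover seat `hubbard-h0-rotor-p1` g32 (route lead; ruling R4-b); helper for piece A = stmt-HubbardSuperconductivity-23918 of rung 19089
(`--supports`, helper class).  Nothing here proves superconductivity in the Hubbard model; one kernel-certified piece of ONE
conditional reduction (the GM₃ ∀L certificate, Level-2 row C = KT-2b on the t-blocks `48 ≤ L < 128`, route-lead ruling R1); the rotor TARGET as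
originally worded stays FALSE (g15 verdict).  Mathlib + the tree only; no sorry.  Generated by p1 g32 scratch/rowcT/mkfilesT.py.
-/

set_option linter.dupNamespace false
set_option autoImplicit false

open Literature.Analysis.ValidatedNumerics

namespace Summit.HubbardSuperconductivity.HubbardSuperconductivity.Theorems.AnisotropyChord.Transfer.Fibre3.L2.KT2b

open L2.N1

/-- ★ the X-sum bracket of the block column `tcRB064N33383`: `XSn ≤ 512/100` for all `L ≥ 64`, `ν ∈ [33383, 34218]/10⁶`. -/
theorem xsTRB064N33383 :
    RowC.xsCellCheck tcRB064N33383.L0 tcRB064N33383.n1 tcRB064N33383.n2 tcRB064N33383.νd tcRB064N33383.Tn tcRB064N33383.Td 1000000 tcRB064N33383.bS2.2 tcRB064N33383.bT10.2 ((128 : ℚ) / 25) = true := by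
  decide +kernel

end Summit.HubbardSuperconductivity.HubbardSuperconductivity.Theorems.AnisotropyChord.Transfer.Fibre3.L2.KT2b
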